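import Literature.NumberTheory.Automorphic.FontaineMazurGL2OddPrime
import Literature.NumberTheory.GaloisRepresentations.OrdinaryTwistedDeterminant
import Literature.NumberTheory.GaloisRepresentations.ResidualQuadraticField
import HarnessLib

/-!
# Modularity of nearly ordinary `2`-adic residually dihedral Galois representations of `Γ_ℚ`
# (Allen 2014, Theorem of the Introduction, base field `F = ℚ`)

Topic `Literature/NumberTheory/Automorphic`; companion of `FontaineMazurGL2OddPrime`,
`FontaineMazurGL2OddPrimeTateTwist` (same classical rendering of "modular": a Tate twist of `ρ` is
the Galois representation of a newform, `IsGaloisRepOfNewform1`) and of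
`Literature.NumberTheory.GaloisRepresentations.ResidualQuadraticField` (which types Allen's
hypothesis (5), `AllenConditionFive`).  One NAMED FACT (D-0014),
`Allen2014_modularity_nearlyOrdinaryDihedral_Q`, no discharge (irreducibly XL: `2`-adic Hida
families, Skinner–Wiles nice primes, Khare–Wintenberger `2`-adic patching).

## The printed theorem (P. B. Allen, *Modularity of nearly ordinary 2-adic residually dihedral
## Galois representations*, Compositio Math. 150 (2014) 1235–1346 = arXiv:1301.1113 [Allen2014];
## held text, Introduction pp. 2–4, quoted)

"**Theorem.** Let `F` be a totally real subfield of `ℚ̄`. … Let `ρ : G_F → GL₂(ℚ̄₂)` be a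
continuous representation unramified outside finitely many primes.  Assume there is some
`(k, w) ∈ J_F²` \[`ℤ^{J_F} × ℤ^{J_F}`\], such that `k_τ ≥ 2` for each `τ ∈ J_F` and
`w = k_τ + 2 w_τ` is independent of `τ`, and such that: (1) `det ρ = φ ε₂^{w−1}`, with `φ` a
finite order character and `ε₂` the `2`-adic cyclotomic character; (2) for each `v ∣ 2`,
`ρ|_{G_v} ≅ ( ∗ ∗ ; 0 χ_v )` and `χ_v(y) = ∏_{τ ∈ J_{F_v}} y^{−w_τ}` on some open subgroup of
`𝒪_{F_v}^×`, viewing `χ_v` as a character of `F_v^×` via class field theory \[normalised so that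
uniformizers correspond to arithmetic Frobenii\]; (3) for each choice of complex conjugation `c`,
`det ρ(c) = −1`.  Let `ρ̄ : G_F → GL₂(𝔽̄₂)` denote the residual representation associated to `ρ`.
We also assume: (4) `ρ̄` is absolutely irreducible with solvable image; (5) letting `L/F` denote
the unique quadratic extension such that `ρ̄|_{G_L}` is abelian, if `L/F` is CM, then there is
some `v ∣ 2` in `F` that does not split in `L`.  Under these assumptions `ρ` is modular, i.e. there
is a `2`-nearly ordinary, regular algebraic, cuspidal automorphic representation `π` of
`GL₂(𝔸_F)` such that `ρ ≅ ρ_π`."  (p. 2: "any absolutely irreducible, `2`-dimensional, mod `2`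
representation with solvable image is dihedral, by the classification of subgroups of
`PGL₂(𝔽̄₂)`"; p. 3: "Condition (2) is the near-ordinarity condition, and it is essential to the
method as we use Hida families"; condition (5) "is related to the fact that when the extension
`L/F` is CM and every `v ∣ 2` in `F` splits in `L`, Hida's universal nearly ordinary Hecke algebra
has CM components.")

## Rendering in the tree's vocabulary — the case `F = ℚ` (read before reviewing)

`-- TODO(general form): Allen proves this for every totally real F (weights (k_τ, w_τ) per
embedding); only F = ℚ is stated, the case the dyadic cruxes over ℚ consume.`

* `ρ` continuous, finitely ramified, (3), (4): `ρ : FramedGaloisRep ℚ (PadicAlgCl 2) 2`,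
  `∀ᶠ v in cofinite, ρ.IsUnramifiedAt v`, `ρ.IsOdd`, `ρ.IsResiduallyAbsIrreducible ∧
  IsSolvable ρ.residualRep.range` ("the residual representation associated to `ρ`" is the
  semisimplified reduction, the tree's chosen `ρ.residualRep`; under `IsResiduallyAbsIrreducible`
  it is a genuine absolutely irreducible reduction and solvability of its range does not depend on
  the choice — `Summits/…/Theorems/DyadicDihedralFM/Negative/`); verbatim the clauses of the crux
  `DyadicOddResidue.DyadicDihedralFM`.
* (5): the accepted `AllenConditionFive ρ.residualRep` (`ResidualQuadraticField`:
  `L = residualQuadraticField ρ̄`, the fixed field of the rotation subgroup, is the unique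
  quadratic field on whose Galois group `ρ̄` is commutative — uniqueness automatic in
  characteristic `2`, loc. cit.; "`L/ℚ` CM" = `L` totally complex; "`2` does not split in `L`" =
  at most one prime of `𝓞_L` over `2`).
* (1) + (2) for `F = ℚ` (one embedding, `k ≥ 2`, `w = k + 2w₀`), WITH THE TATE TWIST FOLDED IN
  (as in the accepted `Pan2022_proModularDeRhamClassical_GL2Q` and
  `Thorne2026_fontaineMazurGL2_potCrystallineOrdinary`): the hypothesis is that some Tate twist
  `ρ' = ρ ⊗ ε₂^a` (`χ₀ σ = cyclotomicPadicAlgCl ℚ 2 σ ^ a`, accepted `FramedRep.twist`) satisfies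
  - (2) in the normalisation `w₀ = 0`: `ρ'` is Skinner–Wiles-ordinary of weight `k ≥ 2` at the
    place above `2` (accepted `FramedGaloisRep.IsOrdinaryOfWeightAt 2 ρ' v k m`, `0 < m`: after a
    change of frame `ρ'|_{Γ_{ℚ₂}} = ( ψ₁ε^{k−1} ∗ ; 0 ψ₂ )` with `ψ₂^m = 1` and
    `(ψ₁ε^{k-1})^m = ε^{(k−1)m}` on inertia).  Then the quotient character `χ_v = ψ₂` is trivial on
    the open subgroup `ker ψ₂|_{I}` of inertia, i.e. `χ_v(y) = 1 = y^{−0}` on an open subgroup of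
    `ℤ₂^×` — Allen's (2) with `w₀ = 0`; conversely Allen's (2) for `ρ` with weights `(k, w₀)` is
    (2) with `w₀ = 0` for the Tate twist `ρ ⊗ ε₂^{−w₀}` (`ε₂(Art y) = y^{−1}` on `ℤ₂^×` in Allen's
    normalisation), whose sub-character is then `ε^{k−1}` times a character finite on inertia by (1);
  - (1): `det ρ' · ε₂^{1−k}` has finite order (`∃ n > 0, ∀ σ, (det ρ'(σ) ε₂(σ)^{1−k})^n = 1`,
    accepted `FramedRep.det`), i.e. `det ρ' = φ ε₂^{w−1}` with `φ` of finite order and `w = k`.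
  Hypotheses (3), (4), (5) and finite ramification are invariant under Tate twists (`ε₂(c)² = 1`;
  `ε̄₂ = 1`, so `ρ ⊗ ε₂^a` and `ρ` have the same reductions; `ε₂` is unramified away from `2`), so
  Allen's theorem applies to `ρ'` and yields that `ρ'`, hence a Tate twist of `ρ`, is modular.
* "modular" (`ρ ≅ ρ_π`, `π` cuspidal regular algebraic `2`-nearly ordinary on `GL₂(𝔸_ℚ)`): the
  CLASSICAL rendering shared with `XZhang2024_fontaineMazurGL2_tateTwist` — for some `χ = ε₂^m`,
  some newform `f ∈ S_k'(Γ₁(N))` and some `ι_f : K_f → ℚ̄₂`, `ρ ⊗ χ` is attached to `f` away from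
  `2N` (`IsGaloisRepOfNewform1 f ι_f {q ∣ N·2} (ρ ⊗ χ)`, arithmetic Frobenius, Deligne–Serre
  normalisation); near-ordinarity of `π` and the local–global compatibility inside `ρ ≅ ρ_π` at the
  ramified places are dropped (weaker fact).

## What is NOT here (and why)

* The general totally real `F` (see the TODO), the main theorem with (4) replaced by "`ρ̄`
  absolutely irreducible with a `2`-nearly ordinary modular lift" (Allen's (finalthm)), the
  corollary on elliptic curves.  No discharge (irreducibly XL).
* Consumers: the dihedral dyadic cruxes `DyadicOddResidue.DyadicDihedralFM` (stmt-Langlands-18742)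
  and `OddResidueBelowFive.TwoAdicDihedral` (stmt-Langlands-18716): this is the printed
  nearly-ordinary cell; its complement inside those cruxes (ρ irreducible at `2`, or (5) failing)
  is open except for Thorne's potentially crystalline ordinary consecutive-weight case.

## References

* P. B. Allen, *Modularity of nearly ordinary 2-adic residually dihedral Galois representations*,
  Compositio Math. 150 (2014) 1235–1346, Theorem and Corollary of the Introduction, §"Strategy";
  arXiv:1301.1113, pp. 2–4. [Allen2014]
* C. Skinner, A. Wiles, *Nearly ordinary deformations of irreducible residual representations*,
  Ann. Fac. Sci. Toulouse 10 (2001) (the strategy; quoted by Allen as [SWirreducible]).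
* C. Khare, J.-P. Wintenberger, Invent. Math. 178 (2009) (the `2`-adic patching).
  [KhareWintenberger2009]
* P. Deligne, J.-P. Serre, Ann. Sci. ÉNS 7 (1974), Thm. 6.1 (normalisation of `ρ_{f,λ}`).
  [DeligneSerreASENS1974]
-/

noncomputable section

open scoped MatrixGroups Matrix NumberField ModularForm
open NumberField IsDedekindDomain Field Filter CongruenceSubgroup

namespace Literature.NumberTheory.Automorphic

open Literature.NumberTheory.GaloisRepresentations
open Literature.NumberTheory.EllipticCurves.ModularForms

/-- **Allen 2014, Theorem of the Introduction, for `F = ℚ`: modularity of `2`-adic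
representations of `Γ_ℚ` that are nearly ordinary at `2` and residually absolutely irreducible
with solvable (dihedral) image, under Allen's condition (5) — rendering with a Tate twist**
(module docstring for the printed statement and the rendering).  Let `ρ : Γ_ℚ → GL₂(ℚ̄₂)` be
continuous, unramified at all but finitely many places and odd, with residual representation
absolutely irreducible of solvable image and satisfying Allen's condition (5) (if the residual
quadratic field `L` is imaginary then `2` does not split in `L`).  Suppose some Tate twist
`ρ' = ρ ⊗ ε₂^a` is Skinner–Wiles-ordinary of some weight `k ≥ 2` at the place above `2`
(`IsOrdinaryOfWeightAt 2 ρ' v k m`, `0 < m`: `ρ'|_{Γ_{ℚ₂}} ≅ ( ψ₁ε₂^{k−1} ∗ ; 0 ψ₂ )` with `ψ₁, ψ₂`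
finite on inertia — Allen's near-ordinarity (2) with `w₀ = 0`) and that `det ρ' · ε₂^{1−k}` has
finite order (Allen's (1)).  Then `ρ` is modular up to a Tate twist: there are a continuous
character `χ : Γ_ℚ → ℚ̄₂ˣ` with `χ(σ) = ε₂(σ)^m` for an integer `m`, a newform `f ∈ S_k'(Γ₁(N))`
and an embedding `ι_f : K_f → ℚ̄₂` of its coefficient field such that `ρ ⊗ χ` is attached to `f`
away from `2N` — unramified at every prime `q ∤ 2N` with
`charpoly (ρ ⊗ χ)(Frob_q) = ι_f(X² − a_q(f) X + ε_f(q) q^{k'−1})` (arithmetic Frobenius).  Named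
fact (D-0014); users take `(h : Allen2014_modularity_nearlyOrdinaryDihedral_Q)`.
[cite: Allen2014, Theorem of the Introduction (arXiv:1301.1113, p. 2), hypotheses (1)–(5)]
[cite: DeligneSerreASENS1974, Thm. 6.1] -/
def Allen2014_modularity_nearlyOrdinaryDihedral_Q : Prop :=
  ∀ (ρ : FramedGaloisRep ℚ (PadicAlgCl 2) 2),
    (∀ᶠ v : HeightOneSpectrum (𝓞 ℚ) in cofinite, ρ.IsUnramifiedAt v) → ρ.IsOdd →
    ρ.IsResiduallyAbsIrreducible → IsSolvable ρ.residualRep.range →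
    AllenConditionFive ρ.residualRep →
    (∃ (χ₀ : absoluteGaloisGroup ℚ →ₜ* (PadicAlgCl 2)ˣ) (a : ℤ) (k m : ℕ),
      (∀ σ, χ₀ σ = cyclotomicPadicAlgCl ℚ 2 σ ^ a) ∧ 2 ≤ k ∧ 0 < m ∧
      (∀ v : HeightOneSpectrum (𝓞 ℚ), ((2 : ℕ) : 𝓞 ℚ) ∈ v.asIdeal →
        FramedGaloisRep.IsOrdinaryOfWeightAt 2 (FramedRep.twist ρ χ₀) v k m) ∧
      ∃ n : ℕ, 0 < n ∧ ∀ σ,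
        (FramedRep.det (FramedRep.twist ρ χ₀) σ * (cyclotomicPadicAlgCl ℚ 2 σ ^ ((k : ℤ) - 1))⁻¹) ^ n = 1) →
    ∃ (χ : absoluteGaloisGroup ℚ →ₜ* (PadicAlgCl 2)ˣ) (m : ℤ),
      (∀ σ, χ σ = cyclotomicPadicAlgCl ℚ 2 σ ^ m) ∧
      ∃ (N : ℕ) (_ : NeZero N) (k : ℤ) (f : CuspForm (Gamma1 N) k)
        (ιf : coeffCharField f →+* PadicAlgCl 2),
        IsNewform1 f ∧ IsGaloisRepOfNewform1 f ιf {q | q ∣ N * 2} (FramedRep.twist ρ χ)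

end Literature.NumberTheory.Automorphic

end
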